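import Literature.Probability.Process.ItoIntegralCovariation
import HarnessLib

/-!
# Stochastic rotation of a Brownian motion: `B' = ∫ R dB` with `R` orthogonal is again a
# Brownian motion of the same filtration (martingale form)

Topic `Probability/Process`; theorems only (no definition, no named fact).  Let `B = (B¹,…,Bᵈ)` be a
`d`-dimensional Brownian motion OF A FILTRATION `𝓕` in Lévy's / martingale form — each `Bʲ` a continuous
square-integrable `𝓕`-martingale and each `Bʲ Bˡ - δ_{jl} t` a martingale — on a probability space, and
let `R_t(ω)` be an `𝓕`-progressive `d' × d` matrix process with ORTHONORMAL ROWS, `R_t R_tᵀ = 1`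
(a "stochastic rotation", solution-dependent in coupling constructions).  Then the process

  `B'ⁱ_t = Σⱼ ∫₀ᵗ R_{ij}(s) dBʲ_s`     (`i < d'`; Itô integrals in the sense of the tree's `IsItoIntegral`)

is again a `d'`-dimensional Brownian motion of `𝓕` in martingale form (`exists_orthogonalIntegral`):
each `B'ⁱ` is a continuous (a.s.) square-integrable `𝓕`-martingale with `B'ⁱ_0 = 0`, and
**`B'ⁱ B'ᵏ - δ_{ik} t` is an `𝓕`-martingale** (`⟨B'ⁱ, B'ᵏ⟩_t = Σⱼ ∫₀ᵗ R_{ij} R_{kj} ds = δ_{ik} t`, from the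
covariation of Itô integrals `IsItoIntegral.integral_mul_sub_mul_sub` and the orthogonality of increments of
square-integrable martingales).  By the vector Lévy characterisation of the tree
(`LevyCharacterisationVecMarkov.lean`: `indep_comap_vecShift_of_martingale`, `exists_isBrownianVec_of_martingale`)
`B'` is then an `𝓕`-Brownian motion; that packaging is NOT repeated here (this file is its martingale input).

This is the measure-theoretic core of reflection / mirror / synchronous couplings (Lindvall–Rogers 1986,
Eberle 2016; Kendall–Cranston couplings): the second copy of the noise is `∫ R dB` for an adapted orthogonal
`R` built from the two solutions, and one needs to know it is a Brownian motion of the COMMON filtration.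

## References

* D. Revuz, M. Yor, *Continuous Martingales and Brownian Motion* (3rd ed., 1999), Ch. IV, Thm (2.2)
  (`⟨K·M, N⟩ = K·⟨M, N⟩`) and Thm (3.6) (Lévy); the statement is e.g. Ch. IV, Exercise (3.22) / the proof of
  Ch. V, Thm (1.9) (orthogonal transforms of Brownian motion).
* T. Lindvall, L. C. G. Rogers, *Coupling of multidimensional diffusions by reflection*, Ann. Probab. 14
  (1986), 860–872, §2 (the reflected noise `dB' = (I - 2 e eᵀ) dB` is a Brownian motion by Lévy's theorem).
-/

set_option autoImplicit false

noncomputable section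

open MeasureTheory ProbabilityTheory Filter Topology Finset
open scoped NNReal ENNReal BigOperators

namespace Literature.Probability.Process

variable {Ω : Type*} {m : MeasurableSpace Ω} {P : Measure Ω} {𝓕 : Filtration ℝ≥0 m} {d d' : ℕ}
  {B : ℝ≥0 → Ω → (Fin d → ℝ)} {R : ℝ≥0 → Ω → Matrix (Fin d') (Fin d) ℝ}

/-! ### Preliminaries -/

/-- Finite sums of martingales are martingales. [folklore] -/
private theorem martingale_finset_sum' {ι : Type*} (s : Finset ι) {f : ι → ℝ≥0 → Ω → ℝ}
    (hf : ∀ k ∈ s, Martingale (f k) 𝓕 P) : Martingale (fun t ω ↦ ∑ k ∈ s, f k t ω) 𝓕 P := by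
  classical
  induction s using Finset.induction_on with
  | empty =>
    simp only [Finset.sum_empty]
    exact martingale_zero ℝ 𝓕 P
  | insert a s ha ih =>
    simp_rw [Finset.sum_insert ha]
    exact (hf a (Finset.mem_insert_self a s)).add (ih fun k hk ↦ hf k (Finset.mem_insert_of_mem hk))

/-- A real process whose set integrals over `𝓕 s`-sets are constant in time is a martingale (both
inequalities of Mathlib's `submartingale_of_setIntegral_le`). [folklore] -/
private theorem martingale_of_setIntegral_eq' [IsFiniteMeasure P] {f : ℝ≥0 → Ω → ℝ}
    (hadp : StronglyAdapted 𝓕 f) (hint : ∀ t, Integrable (f t) P)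
    (hf : ∀ s t : ℝ≥0, s ≤ t → ∀ A : Set Ω, MeasurableSet[𝓕 s] A →
      ∫ ω in A, f s ω ∂P = ∫ ω in A, f t ω ∂P) :
    Martingale f 𝓕 P := by
  have h1 : Submartingale f 𝓕 P :=
    submartingale_of_setIntegral_le hadp hint fun i j hij A hA ↦ (hf i j hij A hA).le
  have h2 : Submartingale (-f) 𝓕 P := by
    refine submartingale_of_setIntegral_le hadp.neg (fun i ↦ (hint i).neg) fun i j hij A hA ↦ ?_
    simp only [Pi.neg_apply, integral_neg]
    exact neg_le_neg (hf i j hij A hA).ge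
  have h3 : Supermartingale f 𝓕 P := by simpa using h2.neg
  exact martingale_iff.2 ⟨h3, h1⟩

/-- Set integrals as integrals against the indicator weight `𝟙_A`. [folklore] -/
private theorem setIntegral_eq_integral_indicator_one_mul {A : Set Ω} (hA : MeasurableSet A) (f : Ω → ℝ) :
    ∫ ω in A, f ω ∂P = ∫ ω, A.indicator (fun _ ↦ (1 : ℝ)) ω * f ω ∂P := by
  rw [← integral_indicator hA]
  congr 1
  funext ω
  by_cases hω : ω ∈ A <;> simp [hω]

/-- Rows of a matrix with `R Rᵀ = 1` are orthonormal: `Σⱼ R_{ij} R_{kj} = δ_{ik}`. [folklore] -/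
private theorem sum_mul_eq_of_mul_transpose {Q : Matrix (Fin d') (Fin d) ℝ} (hQ : Q * Q.transpose = 1)
    (i k : Fin d') : ∑ j, Q i j * Q k j = if i = k then 1 else 0 := by
  have h := congrFun (congrFun hQ i) k
  rw [Matrix.mul_apply, Matrix.one_apply] at h
  simpa [Matrix.transpose_apply] using h

/-- Entries of a matrix with orthonormal rows are bounded by `1`. [folklore] -/
private theorem abs_le_one_of_mul_transpose {Q : Matrix (Fin d') (Fin d) ℝ} (hQ : Q * Q.transpose = 1)
    (i : Fin d') (j : Fin d) : |Q i j| ≤ 1 := by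
  have h := sum_mul_eq_of_mul_transpose hQ i i
  rw [if_pos rfl] at h
  have hle : Q i j * Q i j ≤ ∑ l, Q i l * Q i l :=
    Finset.single_le_sum (fun l _ ↦ mul_self_nonneg (Q i l)) (Finset.mem_univ j)
  rw [h] at hle
  exact abs_le_one_iff_mul_self_le_one.2 hle

/-- A bounded progressive integrand has finite `sqErr` against `0` on every `[0, t]`. [folklore] -/
private theorem sqErr_ne_top_of_abs_le_one {H : ℝ≥0 → Ω → ℝ} [IsFiniteMeasure P]
    (hH : ∀ r ω, |H r ω| ≤ 1) (t : ℝ≥0) : sqErr H 0 P t ≠ ∞ := by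
  have hle : sqErr H 0 P t ≤ ∫⁻ _, (∫⁻ _ in Set.Icc (0 : ℝ) t, ENNReal.ofReal 1) ∂P := by
    unfold sqErr
    refine lintegral_mono fun ω ↦ lintegral_mono fun x ↦ ENNReal.ofReal_le_ofReal ?_
    rw [Pi.zero_apply, Pi.zero_apply, sub_zero, ← sq_abs]
    nlinarith [hH x.toNNReal ω, abs_nonneg (H x.toNNReal ω)]
  have hfin : ∫⁻ _, (∫⁻ _ in Set.Icc (0 : ℝ) t, ENNReal.ofReal 1) ∂P ≠ ∞ := by
    rw [lintegral_const, lintegral_const, Measure.restrict_apply_univ, Real.volume_Icc]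
    exact ENNReal.mul_ne_top (ENNReal.mul_ne_top ENNReal.ofReal_ne_top ENNReal.ofReal_ne_top)
      (measure_ne_top _ _)
  exact ne_top_of_le_ne_top hfin hle

section Hypotheses

variable [IsProbabilityMeasure P]
  (hBm : ∀ j, Martingale (fun t ω ↦ B t ω j) 𝓕 P)
  (hBB : ∀ j l, Martingale (fun t ω ↦ B t ω j * B t ω l - if j = l then (t : ℝ) else 0) 𝓕 P)
  (hB2 : ∀ t j, MemLp (fun ω ↦ B t ω j) 2 P) (hBc : ∀ j ω, Continuous fun t ↦ B t ω j)
  (hR : ∀ i j, IsStronglyProgressive 𝓕 (fun t ω ↦ R t ω i j)) (hRO : ∀ t ω, R t ω * (R t ω).transpose = 1)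

include hBB in
omit [IsProbabilityMeasure P] in
/-- `Bʲ² - t` is a martingale (the diagonal of the bracket hypothesis). [folklore] -/
private theorem martingale_sq_sub (j : Fin d) : Martingale (fun t ω ↦ B t ω j ^ 2 - (t : ℝ)) 𝓕 P := by
  have h := hBB j j
  simp only [if_true] at h
  have heq : (fun t ω ↦ B t ω j ^ 2 - (t : ℝ)) = fun t ω ↦ B t ω j * B t ω j - (t : ℝ) := by
    funext t ω; ring
  rw [heq]; exact h

include hBB in
omit [IsProbabilityMeasure P] in
/-- The bracket hypothesis in the form `Bʲ Bˡ - c t` with `c = δ_{jl}`. [folklore] -/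
private theorem martingale_mul_sub_const (j l : Fin d) :
    Martingale (fun t ω ↦ B t ω j * B t ω l - (if j = l then (1 : ℝ) else 0) * (t : ℝ)) 𝓕 P := by
  have heq : (fun t ω ↦ B t ω j * B t ω l - (if j = l then (1 : ℝ) else 0) * (t : ℝ)) =
      fun t ω ↦ B t ω j * B t ω l - if j = l then (t : ℝ) else 0 := by
    funext t ω
    split_ifs <;> simp
  rw [heq]; exact hBB j l

include hBm hBB hB2 hBc hR hRO in
/-- **The bracket of two rows of `∫ R dB`.**  For Itô integrals `J i j = ∫ R_{ij} dBʲ` (square-integrable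
martingale versions), the rows `Xⁱ = Σⱼ J i j` satisfy, for `s ≤ t` and `A ∈ 𝓕 s`,
`∫_A Xⁱ_t Xᵏ_t = ∫_A Xⁱ_s Xᵏ_s + δ_{ik} (t - s) P(A)`: the cross terms vanish by orthogonality of martingale
increments, and `E[𝟙_A ΔXⁱ ΔXᵏ] = Σⱼₗ δ_{jl} E[𝟙_A ∫_{(s,t]} R_{ij} R_{kl} dr] = δ_{ik} (t - s) P(A)` by the
covariation of Itô integrals and `R Rᵀ = 1`. [cite: RevuzYor1999, Ch. IV Thm (2.2)] -/
theorem setIntegral_orthogonalIntegral_mul_eq (J : Fin d' → Fin d → ℝ≥0 → Ω → ℝ)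
    (hJ : ∀ i j, IsItoIntegral (fun t ω ↦ R t ω i j) (fun t ω ↦ B t ω j) (J i j) 𝓕 P)
    (hJM : ∀ i j, Martingale (J i j) 𝓕 P) (hJ2 : ∀ i j t, MemLp (J i j t) 2 P)
    (i k : Fin d') {s t : ℝ≥0} (hst : s ≤ t) {A : Set Ω} (hA : MeasurableSet[𝓕 s] A) :
    ∫ ω in A, (∑ j, J i j t ω) * (∑ j, J k j t ω) ∂P =
      (∫ ω in A, (∑ j, J i j s ω) * (∑ j, J k j s ω) ∂P) +
        (if i = k then (1 : ℝ) else 0) * ((t : ℝ) - s) * P.real A := by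
  classical
  have hA' : MeasurableSet A := 𝓕.le s A hA
  have hRb : ∀ i j r ω, |R r ω i j| ≤ 1 := fun i j r ω ↦ abs_le_one_of_mul_transpose (hRO r ω) i j
  have hfin : ∀ i j (t : ℝ≥0), sqErr (fun t ω ↦ R t ω i j) 0 P t ≠ ∞ := fun i j t ↦
    sqErr_ne_top_of_abs_le_one (fun r ω ↦ hRb i j r ω) t
  have hBsq := martingale_sq_sub hBB
  have hRm : ∀ i j, Measurable fun p : Ω × ℝ ↦ R p.2.toNNReal p.1 i j := fun i j ↦
    measurable_toNNReal_of_isStronglyProgressive (hR i j)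
  -- the rows and their martingale / `L²` properties
  have hXM : Martingale (fun t ω ↦ ∑ j, J i j t ω) 𝓕 P := martingale_finset_sum' Finset.univ fun j _ ↦ hJM i j
  have hYM : Martingale (fun t ω ↦ ∑ j, J k j t ω) 𝓕 P := martingale_finset_sum' Finset.univ fun j _ ↦ hJM k j
  have hX2 : ∀ t, MemLp (fun ω ↦ ∑ j, J i j t ω) 2 P := fun t ↦ memLp_finsetSum _ fun j _ ↦ hJ2 i j t
  have hY2 : ∀ t, MemLp (fun ω ↦ ∑ j, J k j t ω) 2 P := fun t ↦ memLp_finsetSum _ fun j _ ↦ hJ2 k j t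
  -- the indicator weight
  set Z : Ω → ℝ := A.indicator fun _ ↦ (1 : ℝ) with hZ
  have hZm : StronglyMeasurable[𝓕 s] Z := (stronglyMeasurable_const (b := (1 : ℝ))).indicator hA
  have hZm' : AEStronglyMeasurable Z P := (hZm.mono (𝓕.le s)).aestronglyMeasurable
  have hZb : ∀ ω, |Z ω| ≤ 1 := fun ω ↦ by by_cases hω : ω ∈ A <;> simp [hZ, hω]
  have hZb' : ∀ᵐ ω ∂P, ‖Z ω‖ ≤ 1 := ae_of_all _ fun ω ↦ by rw [Real.norm_eq_abs]; exact hZb ω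
  have hZind : ∀ f : Ω → ℝ, (fun ω ↦ Z ω * f ω) = A.indicator f := by
    intro f; funext ω; by_cases hω : ω ∈ A <;> simp [hZ, hω]
  have hZint : ∫ ω, Z ω ∂P = P.real A := by
    rw [hZ, integral_indicator hA', setIntegral_const, smul_eq_mul, mul_one]
  -- (K1)/(K2): cross terms vanish
  have hK1 : ∫ ω, (Z ω * ∑ j, J i j s ω) * ((∑ j, J k j t ω) - ∑ j, J k j s ω) ∂P = 0 := by
    refine integral_mul_sub_eq_zero_of_martingale_of_memLp hYM hY2 hst (hZm.mul (hXM.stronglyMeasurable s)) ?_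
    rw [hZind]; exact (hX2 s).indicator hA'
  have hK2 : ∫ ω, (Z ω * ∑ j, J k j s ω) * ((∑ j, J i j t ω) - ∑ j, J i j s ω) ∂P = 0 := by
    refine integral_mul_sub_eq_zero_of_martingale_of_memLp hXM hX2 hst (hZm.mul (hYM.stronglyMeasurable s)) ?_
    rw [hZind]; exact (hY2 s).indicator hA'
  -- (K3): the product of the increments
  have hjl : ∀ j l : Fin d, ∫ ω, Z ω * ((J i j t ω - J i j s ω) * (J k l t ω - J k l s ω)) ∂P =
      (if j = l then (1 : ℝ) else 0) *
        ∫ ω, Z ω * (∫ r in Set.Ioc (s : ℝ) t, R r.toNNReal ω i j * R r.toNNReal ω k l) ∂P :=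
    fun j l ↦ IsItoIntegral.integral_mul_sub_mul_sub (hBm j) (hBsq j) (fun t ↦ hB2 t j) (hBc j) (hBm l)
      (hBsq l) (fun t ↦ hB2 t l) (hBc l) (martingale_mul_sub_const hBB j l) (hR i j) (hR k l) (hfin i j)
      (hfin k l) (hJ i j) (hJ k l) hst hZm hZb
  -- the time integrals `T j ω = ∫_{(s,t]} R_{ij} R_{kj} dr`
  have hTm : ∀ j l : Fin d, AEStronglyMeasurable
      (fun ω ↦ ∫ r in Set.Ioc (s : ℝ) t, R r.toNNReal ω i j * R r.toNNReal ω k l) P := by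
    intro j l
    have h := ((hRm i j).mul (hRm k l)).stronglyMeasurable
    exact (h.integral_prod_right' (ν := volume.restrict (Set.Ioc (s : ℝ) t))).aestronglyMeasurable
  have hTb : ∀ (j l : Fin d) ω, ‖∫ r in Set.Ioc (s : ℝ) t, R r.toNNReal ω i j * R r.toNNReal ω k l‖ ≤ (t : ℝ) - s := by
    intro j l ω
    have h := norm_setIntegral_le_of_norm_le_const (μ := volume) (s := Set.Ioc (s : ℝ) t)
      (f := fun r : ℝ ↦ R r.toNNReal ω i j * R r.toNNReal ω k l) (C := 1) measure_Ioc_lt_top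
      (fun r _ ↦ by
        rw [norm_mul, Real.norm_eq_abs, Real.norm_eq_abs]
        calc |R r.toNNReal ω i j| * |R r.toNNReal ω k l| ≤ 1 * 1 :=
            mul_le_mul (hRb i j _ ω) (hRb k l _ ω) (abs_nonneg _) zero_le_one
          _ = 1 := one_mul 1)
    rwa [Real.volume_real_Ioc_of_le (NNReal.coe_le_coe.2 hst), one_mul] at h
  have hZTint : ∀ j l : Fin d, Integrable
      (fun ω ↦ Z ω * ∫ r in Set.Ioc (s : ℝ) t, R r.toNNReal ω i j * R r.toNNReal ω k l) P := by
    intro j l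
    refine (integrable_const ((t : ℝ) - s)).mono' (hZm'.mul (hTm j l)) (ae_of_all _ fun ω ↦ ?_)
    rw [norm_mul]
    calc ‖Z ω‖ * ‖∫ r in Set.Ioc (s : ℝ) t, R r.toNNReal ω i j * R r.toNNReal ω k l‖ ≤ 1 * ((t : ℝ) - s) :=
        mul_le_mul (by rw [Real.norm_eq_abs]; exact hZb ω) (hTb j l ω) (norm_nonneg _) zero_le_one
      _ = (t : ℝ) - s := one_mul _
  -- pathwise: `Σⱼ ∫_{(s,t]} R_{ij} R_{kj} = δ_{ik} (t - s)`
  have hpath : ∀ ω, ∑ j, ∫ r in Set.Ioc (s : ℝ) t, R r.toNNReal ω i j * R r.toNNReal ω k j =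
      (if i = k then (1 : ℝ) else 0) * ((t : ℝ) - s) := by
    intro ω
    have hint : ∀ j, IntegrableOn (fun r : ℝ ↦ R r.toNNReal ω i j * R r.toNNReal ω k j) (Set.Ioc (s : ℝ) t) := by
      intro j
      have hm : AEStronglyMeasurable (fun r : ℝ ↦ R r.toNNReal ω i j * R r.toNNReal ω k j)
          (volume.restrict (Set.Ioc (s : ℝ) t)) :=
        (((hRm i j).comp measurable_prodMk_left).mul ((hRm k j).comp measurable_prodMk_left)).aestronglyMeasurable
      refine ⟨hm, HasFiniteIntegral.of_bounded (μ := volume.restrict (Set.Ioc (s : ℝ) t)) (C := 1)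
        (ae_of_all _ fun r ↦ ?_)⟩
      rw [norm_mul, Real.norm_eq_abs, Real.norm_eq_abs]
      calc |R r.toNNReal ω i j| * |R r.toNNReal ω k j| ≤ 1 * 1 :=
          mul_le_mul (hRb i j _ ω) (hRb k j _ ω) (abs_nonneg _) zero_le_one
        _ = 1 := one_mul 1
    rw [← integral_finsetSum _ fun j _ ↦ hint j]
    have hsum : ∀ r : ℝ, ∑ j, R r.toNNReal ω i j * R r.toNNReal ω k j = if i = k then (1 : ℝ) else 0 :=
      fun r ↦ sum_mul_eq_of_mul_transpose (hRO r.toNNReal ω) i k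
    simp_rw [hsum]
    rw [setIntegral_const, Real.volume_real_Ioc_of_le (NNReal.coe_le_coe.2 hst), smul_eq_mul, mul_comm]
  have hK3 : ∫ ω, Z ω * (((∑ j, J i j t ω) - ∑ j, J i j s ω) * ((∑ j, J k j t ω) - ∑ j, J k j s ω)) ∂P =
      (if i = k then (1 : ℝ) else 0) * ((t : ℝ) - s) * P.real A := by
    -- expand the product of the increments
    have hexp : ∀ ω, Z ω * (((∑ j, J i j t ω) - ∑ j, J i j s ω) * ((∑ j, J k j t ω) - ∑ j, J k j s ω)) =
        ∑ j, ∑ l, Z ω * ((J i j t ω - J i j s ω) * (J k l t ω - J k l s ω)) := by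
      intro ω
      rw [← Finset.sum_sub_distrib, ← Finset.sum_sub_distrib, Finset.sum_mul_sum, Finset.mul_sum]
      refine Finset.sum_congr rfl fun j _ ↦ ?_
      rw [Finset.mul_sum]
    simp_rw [hexp]
    have hint1 : ∀ j l : Fin d, Integrable (fun ω ↦ Z ω * ((J i j t ω - J i j s ω) * (J k l t ω - J k l s ω))) P := by
      intro j l
      have h1 : Integrable (fun ω ↦ (J i j t ω - J i j s ω) * (J k l t ω - J k l s ω)) P :=
        ((hJ2 i j t).sub (hJ2 i j s)).integrable_mul ((hJ2 k l t).sub (hJ2 k l s))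
      exact h1.bdd_mul hZm' hZb'
    rw [integral_finsetSum _ fun j _ ↦ integrable_finsetSum _ fun l _ ↦ hint1 j l]
    simp_rw [integral_finsetSum _ fun l _ ↦ hint1 _ l, hjl]
    -- collapse the Kronecker delta in `l`
    have hcol : ∀ j : Fin d, ∑ l, (if j = l then (1 : ℝ) else 0) *
        ∫ ω, Z ω * (∫ r in Set.Ioc (s : ℝ) t, R r.toNNReal ω i j * R r.toNNReal ω k l) ∂P =
        ∫ ω, Z ω * (∫ r in Set.Ioc (s : ℝ) t, R r.toNNReal ω i j * R r.toNNReal ω k j) ∂P := by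
      intro j
      simp_rw [ite_mul, one_mul, zero_mul]
      rw [Finset.sum_ite_eq Finset.univ j, if_pos (Finset.mem_univ j)]
    simp_rw [hcol]
    rw [← integral_finsetSum _ fun j _ ↦ hZTint j j]
    simp_rw [← Finset.mul_sum, hpath]
    rw [integral_mul_const, hZint, mul_comm]
  -- assemble
  have hXYt : Integrable (fun ω ↦ (∑ j, J i j t ω) * (∑ j, J k j t ω)) P := (hX2 t).integrable_mul (hY2 t)
  have hXYs : Integrable (fun ω ↦ (∑ j, J i j s ω) * (∑ j, J k j s ω)) P := (hX2 s).integrable_mul (hY2 s)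
  have hdiff : (∫ ω in A, (∑ j, J i j t ω) * (∑ j, J k j t ω) ∂P) - ∫ ω in A, (∑ j, J i j s ω) * (∑ j, J k j s ω) ∂P =
      (if i = k then (1 : ℝ) else 0) * ((t : ℝ) - s) * P.real A := by
    rw [← integral_sub hXYt.integrableOn hXYs.integrableOn, setIntegral_eq_integral_indicator_one_mul hA']
    have hpt : ∀ ω, Z ω * ((∑ j, J i j t ω) * (∑ j, J k j t ω) - (∑ j, J i j s ω) * (∑ j, J k j s ω)) =
        Z ω * (((∑ j, J i j t ω) - ∑ j, J i j s ω) * ((∑ j, J k j t ω) - ∑ j, J k j s ω)) +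
          (Z ω * ∑ j, J i j s ω) * ((∑ j, J k j t ω) - ∑ j, J k j s ω) +
          (Z ω * ∑ j, J k j s ω) * ((∑ j, J i j t ω) - ∑ j, J i j s ω) := fun ω ↦ by ring
    have hI1 : Integrable (fun ω ↦ Z ω * (((∑ j, J i j t ω) - ∑ j, J i j s ω) *
        ((∑ j, J k j t ω) - ∑ j, J k j s ω))) P :=
      (((hX2 t).sub (hX2 s)).integrable_mul ((hY2 t).sub (hY2 s))).bdd_mul hZm' hZb'
    have hI2 : Integrable (fun ω ↦ (Z ω * ∑ j, J i j s ω) * ((∑ j, J k j t ω) - ∑ j, J k j s ω)) P := by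
      have h : MemLp (fun ω ↦ Z ω * ∑ j, J i j s ω) 2 P := by rw [hZind]; exact (hX2 s).indicator hA'
      exact h.integrable_mul ((hY2 t).sub (hY2 s))
    have hI3 : Integrable (fun ω ↦ (Z ω * ∑ j, J k j s ω) * ((∑ j, J i j t ω) - ∑ j, J i j s ω)) P := by
      have h : MemLp (fun ω ↦ Z ω * ∑ j, J k j s ω) 2 P := by rw [hZind]; exact (hY2 s).indicator hA'
      exact h.integrable_mul ((hX2 t).sub (hX2 s))
    have hI12 : Integrable (fun ω ↦ Z ω * (((∑ j, J i j t ω) - ∑ j, J i j s ω) *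
        ((∑ j, J k j t ω) - ∑ j, J k j s ω)) +
          (Z ω * ∑ j, J i j s ω) * ((∑ j, J k j t ω) - ∑ j, J k j s ω)) P := hI1.add hI2
    change ∫ ω, Z ω * ((∑ j, J i j t ω) * (∑ j, J k j t ω) - (∑ j, J i j s ω) * (∑ j, J k j s ω)) ∂P = _
    simp_rw [hpt]
    rw [integral_add hI12 hI3, integral_add hI1 hI2, hK1, hK2, hK3, add_zero, add_zero]
  linarith

include hBm hBB hB2 hBc hR hRO in
/-- ★ **Stochastic rotation of a Brownian motion (martingale form).**  For `B` a `d`-dimensional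
`𝓕`-Brownian motion in martingale form and `R` an `𝓕`-progressive matrix process with orthonormal rows
(`R Rᵀ = 1`), there is a process `B' : ℝ≥0 → Ω → ℝ^{d'}` with `B'ⁱ = Σⱼ ∫ R_{ij} dBʲ` (Itô integrals
`IsItoIntegral`) such that every `B'ⁱ` is a square-integrable `𝓕`-martingale, every
`B'ⁱ B'ᵏ - δ_{ik} t` is an `𝓕`-martingale, `B' 0 = 0`, and almost every path of `B'` is continuous — i.e.
`B'` satisfies the hypotheses of the tree's vector Lévy characterisation w.r.t. the SAME filtration `𝓕`.
[cite: RevuzYor1999, Ch. IV Thm (2.2)] -/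
theorem exists_orthogonalIntegral :
    ∃ B' : ℝ≥0 → Ω → (Fin d' → ℝ),
      (∃ J : Fin d' → Fin d → ℝ≥0 → Ω → ℝ,
        (∀ i j, IsItoIntegral (fun t ω ↦ R t ω i j) (fun t ω ↦ B t ω j) (J i j) 𝓕 P) ∧
        ∀ t ω i, B' t ω i = ∑ j, J i j t ω) ∧
      (∀ i, Martingale (fun t ω ↦ B' t ω i) 𝓕 P) ∧
      (∀ i k, Martingale (fun t ω ↦ B' t ω i * B' t ω k - if i = k then (t : ℝ) else 0) 𝓕 P) ∧
      (∀ t i, MemLp (fun ω ↦ B' t ω i) 2 P) ∧ (∀ ω, B' 0 ω = 0) ∧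
      ∀ᵐ ω ∂P, Continuous fun t ↦ B' t ω := by
  classical
  -- bounded entries, finite `sqErr`
  have hRb : ∀ i j r ω, |R r ω i j| ≤ 1 := fun i j r ω ↦ abs_le_one_of_mul_transpose (hRO r ω) i j
  have hfin : ∀ i j (t : ℝ≥0), sqErr (fun t ω ↦ R t ω i j) 0 P t ≠ ∞ := fun i j t ↦
    sqErr_ne_top_of_abs_le_one (fun r ω ↦ hRb i j r ω) t
  have hBsq := martingale_sq_sub hBB
  -- the Itô integrals `J i j = ∫ R_{ij} dBʲ`, square-integrable martingale versions
  have hex : ∀ i j, ∃ J : ℝ≥0 → Ω → ℝ, IsItoIntegral (fun t ω ↦ R t ω i j) (fun t ω ↦ B t ω j) J 𝓕 P ∧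
      Martingale J 𝓕 P ∧ ∀ t, MemLp (J t) 2 P := by
    intro i j
    obtain ⟨J, h1, h2, h3, -⟩ := exists_isItoIntegral_of_sqErr_ne_top (hBm j) (hBsq j) (fun t ↦ hB2 t j)
      (hBc j) (hR i j) (hfin i j)
    exact ⟨J, h1, h2, h3⟩
  choose J hJ hJM hJ2 using hex
  refine ⟨fun t ω i ↦ ∑ j, J i j t ω, ⟨J, hJ, fun t ω i ↦ rfl⟩, fun i ↦ ?_, fun i k ↦ ?_, fun t i ↦ ?_,
    fun ω ↦ ?_, ?_⟩
  · -- martingale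
    exact martingale_finset_sum' Finset.univ fun j _ ↦ hJM i j
  · -- the bracket `B'ⁱ B'ᵏ - δ_{ik} t` is a martingale
    have hXM : Martingale (fun t ω ↦ ∑ j, J i j t ω) 𝓕 P := martingale_finset_sum' Finset.univ fun j _ ↦ hJM i j
    have hYM : Martingale (fun t ω ↦ ∑ j, J k j t ω) 𝓕 P := martingale_finset_sum' Finset.univ fun j _ ↦ hJM k j
    have hX2 : ∀ t, MemLp (fun ω ↦ ∑ j, J i j t ω) 2 P := fun t ↦ memLp_finsetSum _ fun j _ ↦ hJ2 i j t
    have hY2 : ∀ t, MemLp (fun ω ↦ ∑ j, J k j t ω) 2 P := fun t ↦ memLp_finsetSum _ fun j _ ↦ hJ2 k j t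
    refine martingale_of_setIntegral_eq' ?_ ?_ ?_
    · intro t
      exact ((hXM.stronglyMeasurable t).mul (hYM.stronglyMeasurable t)).sub stronglyMeasurable_const
    · intro t
      exact ((hX2 t).integrable_mul (hY2 t)).sub (integrable_const _)
    intro s t hst A hA
    have hA' : MeasurableSet A := 𝓕.le s A hA
    have hXYt : Integrable (fun ω ↦ (∑ j, J i j t ω) * (∑ j, J k j t ω)) P := (hX2 t).integrable_mul (hY2 t)
    have hXYs : Integrable (fun ω ↦ (∑ j, J i j s ω) * (∑ j, J k j s ω)) P := (hX2 s).integrable_mul (hY2 s)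
    have key := setIntegral_orthogonalIntegral_mul_eq hBm hBB hB2 hBc hR hRO J hJ hJM hJ2 i k hst hA
    rw [integral_sub hXYs.integrableOn ((integrable_const _).integrableOn),
      integral_sub hXYt.integrableOn ((integrable_const _).integrableOn), key, setIntegral_const,
      setIntegral_const, smul_eq_mul, smul_eq_mul]
    split_ifs <;> ring
  · exact memLp_finsetSum _ fun j _ ↦ hJ2 i j t
  · funext i
    simp only [Pi.zero_apply]
    exact Finset.sum_eq_zero fun j _ ↦ (hJ i j).apply_zero ω
  · have hall : ∀ᵐ ω ∂P, ∀ i j, Continuous fun t ↦ J i j t ω := by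
      rw [ae_all_iff]; intro i; rw [ae_all_iff]; intro j
      exact (hJ i j).continuous
    filter_upwards [hall] with ω hω
    exact continuous_pi fun i ↦ continuous_finsetSum _ fun j _ ↦ hω i j

end Hypotheses

end Literature.Probability.Process

end
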